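import Summits.BirchSwinnertonDyer.Rank1Residual.X11b.BDPRouteWholeClass
import Summits.BirchSwinnertonDyer.Rank1Residual.X11b.MultiplicativeSurjectivity
import HarnessLib

/-!
# Class X11b, route "BDP + converse-theorem engine + Kolyvagin": the whole-class theorem with the non-surjective corner (T4) DISCHARGED at `p ≥ 11` and LOCALISED at `p ∈ {5, 7}` (cell `b2b-bsdres`, sub-cell `multr1-p2`, gen 8)

HONEST FRAMING (verbatim, cell `b2b-bsdres`): the goal of the cell is to DELETE the
COMBINATION-SHAPED residual classes for ALL analytic-rank `≤ 1` curves over `ℚ` — "full BSD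
formula for every rank `≤ 1` curve in class `C`" assembled STRICTLY from published theorems — so
that the rank-`≤ 1` remainder becomes exactly the CONSTRUCTION-SHAPED classes, which are TYPED
(missing-input Props), NOT attempted; this is not "finishing BSD". Research route `p2` for class
X11b; no claim beyond the stated class; nothing booked; X11b stays CONSTRUCTION-SHAPED. Theorems
only (no definition, no new named fact).

## What this file does

Gen 7's `bsdp_of_classX11b_five_of_typedInputs` (`BDPRouteWholeClass.lean`) pins `BSD(E,p)` for
every X11b pair with `p ≥ 5` on twelve PUBLISHED facts and four TYPED inputs: (T1) STEP L on the
surjective pairs, (T2) the Euler-system half where `p ∣ ∏c_ℓ`, (T3) X11a's lower half, (T4)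
`Typed.MissingPPartAt` on the NON-SURJECTIVE corner `ClassX11b ∧ ¬Surj`.  Two Galois-image
theorems now bound (T4):

* x11c gen 7, `ClassX11b.surj_of_eleven_le` (Bilu–Parent–Rebolledo 2013 / BDMTV 2019, named fact
  `hBDMTV = thm12_not_le_normalizer_splitCartan`): at `p ≥ 11` every X11b pair is surjective;
* this unit's gen 8, `ClassX11b.not_surj_shape` (`MultiplicativeSurjectivity.lean`, from the new
  tree theorem `exists_inertia_transvection_of_hasMultiplicativeReductionAt_of_not_dvd` =
  Silverman *ATAEC* V.6 Prop. 6.1 at `ℓ = p`, + Serre Prop. 15): a non-surjective X11b pair with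
  `p ≥ 5` has `p ∈ {5, 7}`, `p ∣ ord_p Δ_min(E)` and no (ram) prime.

Hence:

* `bsdp_of_classX11b_of_surj_of_typedInputs` — the surjective branch of the class theorem,
  pointwise: published facts + (T1) + (T2) + (T3) ⟹ `BSD(E,p)` for every SURJECTIVE X11b pair with
  `p ≥ 5` (no (T4)).
* **`bsdp_of_classX11b_eleven_of_typedInputs`** — at `p ≥ 11` the class theorem needs (T1)–(T3)
  only: (T4) is DISCHARGED (given `hBDMTV`).
* **`bsdp_of_classX11b_five_of_typedInputs_local`** — at `p ≥ 5` the class theorem with (T4)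
  replaced by (T4′): `Typed.MissingPPartAt` on the DECIDABLE sub-population
  `ClassX11b ∧ (p = 5 ∨ p = 7) ∧ p ∣ ord_p Δ_min ∧ ¬Ram` (class-wide Cremona `N < 5·10⁵`: the same
  `64` pairs, all at `p = 5`; REPORT §13.3/§14).

CONDITIONAL theorems (the typed inputs are OPEN); nothing booked; labels unchanged.

## References

* [SilvermanATAEC1994] V.6 Prop. 6.1; [SerreInventiones1972] §1.12, §2.4 Prop. 15;
  [BalakrishnanEtAl2019] Thm. 1.2; [BiluParentRebolledo2013] Cor. 1.2; and the references of
  `BDPRouteWholeClass.lean` ([JetchevSkinnerWan2017] §7.4; [Kolyvagin1990]; [Skinner2016PacificMC]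
  Thm. C; [Wuthrich2014] Prop. 21; [Mazur1978] Cor. 4.1; [Miller2011LMS] Def. 1.1).
-/

noncomputable section

open scoped Classical

open WeierstrassCurve NumberField Literature.NumberTheory.EllipticCurves
  Literature.NumberTheory.EllipticCurves.ModularForms
  Literature.NumberTheory.EllipticCurves.Rank1Residual
  Literature.NumberTheory.EllipticCurves.Rank1Residual.Typed
  Literature.NumberTheory.EllipticCurves.Wuthrich2014
  Literature.NumberTheory.EllipticCurves.BalakrishnanEtAl2019

namespace Summit.BirchSwinnertonDyer.Rank1Residual.X11b

/-! ### The surjective branch of the class theorem, pointwise -/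

/-- **X11b, surjective pairs, `p ≥ 5`: `BSD(E,p)` from the published facts and (T1)–(T3) only.**
For an X11b pair `(E,p)` with `p ≥ 5` and `ρ̄_{E,p}` onto: lower half from STEP L on the surjective
pairs (`missingLowerBoundAt_of_classX11b_of_surj_odd`), upper half unconditional on (ram) ∧
`p ∤ ∏c_ℓ`, from (T2) where `p ∣ ∏c_ℓ`, from (T3) on `¬`(ram) ∧ `p ∤ ∏c_ℓ`
(`missingUpperBoundAt_of_classX11b_of_not_ram_of_lowerX11a`). CONDITIONAL; nothing booked.
[cite: JetchevSkinnerWan2017, §7.4.1–7.4.3 (pp. 30–31)] [cite: McCallumLMS1991, §1 Theorem (Kolyvagin), p. 296]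
[cite: Skinner2016PacificMC, Thm. C (§1) and footnote 1] [cite: Wuthrich2014, Prop. 21 (p. 400)]
[cite: Miller2011LMS, Def. 1.1] -/
theorem bsdp_of_classX11b_of_surj_of_typedInputs
    -- published inputs (named facts of the tree)
    (hGZ : ∀ (N : ℕ) [NeZero N] (W : WeierstrassCurve ℚ) (K : Type) [Field K] [NumberField K],
      gross_zagier N W K)
    (hKo : ∀ (N : ℕ) [NeZero N] (W : WeierstrassCurve ℚ) (K : Type) [Field K] [NumberField K],
      kolyvagin N W K)
    (hB : ∀ (N : ℕ) [NeZero N] (W : WeierstrassCurve ℚ) (K : Type) [Field K] [NumberField K],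
      Kolyvagin1990_padicValNat_card_sha_le N W K)
    (hSk : Skinner2016.thmC_padicValRat_bsd_rank_zero) (hWu : sha_dvd_analyticSha)
    (hGZK : rank_eq_analyticRank_of_analyticRank_le_one) (hmod : hasEntireLFunction_rat)
    (hnf : exists_isNewformOf) (hHL : HoffsteinLuo1997_exists_twist_L_one_ne_zero)
    (hFH : friedbergHoffstein_exists_heegnerField_split_twist_ne_zero)
    (hMaz : mazur_not_dvd_maninConstant_of_odd) (hNS : integral_neronScaling_of_isGloballyMinimal)
    -- (T1) the typed input of the route (STEP L), at the odd-`d_K` Heegner data of surjective X11b pairs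
    (hL : ∀ (W : WeierstrassCurve ℚ) [W.IsElliptic] [W.IsGloballyMinimal] (p : ℕ) [Fact p.Prime]
      (N : ℕ) [NeZero N] (K : Type) [Field K] [NumberField K]
      (Dt : ModularParametrizationData W N) (H : HeegnerDatum N (NumberField.discr K)) (ι : K →+* ℂ)
      (P : (W.baseChange K).toAffine.Point),
      ClassX11b W p → Surj W p → W.conductorNorm ℤ = N → IsImaginaryQuadratic K →
      Odd (NumberField.discr K) → ¬ (p : ℤ) ∣ NumberField.discr K → ¬ p ∣ Units.torsionOrder K →
      SatisfiesHeegnerHypothesis N K →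
      (W.quadraticTwist (NumberField.discr K : ℚ)).entireLFunction 1 ≠ 0 →
      WeierstrassCurve.Affine.Point.map ι.toRatAlgHom P = heegnerPointComplex Dt H →
      ¬ (p : ℤ) ∣ Dt.c → IndexLowerBoundAt W p K P)
    -- (T2) the Euler-system half where `p ∣ ∏ c_ℓ`
    (hU : ∀ (W : WeierstrassCurve ℚ) [W.IsElliptic] [W.IsGloballyMinimal] (p : ℕ) [Fact p.Prime],
      ClassX11b W p → 5 ≤ p → p ∣ W.tamagawaProduct → Typed.MissingUpperBoundAt W p)
    -- (T3) the main-conjecture half on the rank-0 sister class X11a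
    (hX11a : ∀ (Wd : WeierstrassCurve ℚ) [Wd.IsElliptic] [Wd.IsGloballyMinimal] (p : ℕ)
      [Fact p.Prime], ClassX11a Wd p → Typed.MissingLowerBoundAt Wd p) :
    ∀ (W : WeierstrassCurve ℚ) [W.IsElliptic] [W.IsGloballyMinimal] (p : ℕ) [Fact p.Prime],
      ClassX11b W p → 5 ≤ p → Surj W p → BSDp W p := by
  intro W _ _ p _ hX hp5 hs
  refine Typed.bsdp_of_missingPPartAt W p hGZK (by rw [hX.1]) ?_
  refine Typed.missingPPartAt_of_lower_of_upper W p
    (missingLowerBoundAt_of_classX11b_of_surj_odd hGZ hKo hWu hGZK hmod hnf hHL hMaz hNS hL W p hX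
      hs) ?_
  by_cases ht : p ∣ W.tamagawaProduct
  · exact hU W p hX hp5 ht
  by_cases hram : Ram W p
  · exact missingUpperBoundAt_of_classX11b_of_ram_of_not_dvd hGZ hKo hB hSk hGZK hmod hnf hHL hMaz
      hNS W p hX hram ht
  · exact missingUpperBoundAt_of_classX11b_of_not_ram_of_lowerX11a hGZ hKo hB hGZK hmod hnf hFH hMaz
      hNS W p hX hp5 hram hs ht (fun Wd _ _ hXa ↦ hX11a Wd p hXa)

/-! ### `p ≥ 11`: the non-surjective corner is EMPTY — (T4) discharged -/

/-- **X11b, whole class, `p ≥ 11`: `BSD(E,p)` for EVERY pair `(E,p)` of X11b with `p ≥ 11`, from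
the published facts (now thirteen: + BDMTV 2019 Thm. 1.2 / Bilu–Parent–Rebolledo 2013, `hBDMTV`)
and the THREE typed inputs (T1) STEP L, (T2) the upper half where `p ∣ ∏c_ℓ`, (T3) X11a's lower
half.** The non-surjective corner (T4) of `bsdp_of_classX11b_five_of_typedInputs` is DISCHARGED:
`ClassX11b.surj_of_eleven_le` (x11c gen 7). CONDITIONAL; nothing booked; X11b stays
CONSTRUCTION-SHAPED. [cite: BalakrishnanEtAl2019, §1 Thm. 1.2 (arXiv:1711.05846 p. 2)]
[cite: BiluParentRebolledo2013, Cor. 1.2] [cite: JetchevSkinnerWan2017, §7.4.1–7.4.3 (pp. 30–31)]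
[cite: Skinner2016PacificMC, Thm. C (§1) and footnote 1] [cite: Wuthrich2014, Prop. 21 (p. 400)] -/
theorem bsdp_of_classX11b_eleven_of_typedInputs
    -- published inputs (named facts of the tree)
    (hGZ : ∀ (N : ℕ) [NeZero N] (W : WeierstrassCurve ℚ) (K : Type) [Field K] [NumberField K],
      gross_zagier N W K)
    (hKo : ∀ (N : ℕ) [NeZero N] (W : WeierstrassCurve ℚ) (K : Type) [Field K] [NumberField K],
      kolyvagin N W K)
    (hB : ∀ (N : ℕ) [NeZero N] (W : WeierstrassCurve ℚ) (K : Type) [Field K] [NumberField K],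
      Kolyvagin1990_padicValNat_card_sha_le N W K)
    (hSk : Skinner2016.thmC_padicValRat_bsd_rank_zero) (hWu : sha_dvd_analyticSha)
    (hGZK : rank_eq_analyticRank_of_analyticRank_le_one) (hmod : hasEntireLFunction_rat)
    (hnf : exists_isNewformOf) (hHL : HoffsteinLuo1997_exists_twist_L_one_ne_zero)
    (hFH : friedbergHoffstein_exists_heegnerField_split_twist_ne_zero)
    (hMaz : mazur_not_dvd_maninConstant_of_odd) (hNS : integral_neronScaling_of_isGloballyMinimal)
    (hBDMTV : thm12_not_le_normalizer_splitCartan)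
    -- (T1) the typed input of the route (STEP L), at the odd-`d_K` Heegner data of surjective X11b pairs
    (hL : ∀ (W : WeierstrassCurve ℚ) [W.IsElliptic] [W.IsGloballyMinimal] (p : ℕ) [Fact p.Prime]
      (N : ℕ) [NeZero N] (K : Type) [Field K] [NumberField K]
      (Dt : ModularParametrizationData W N) (H : HeegnerDatum N (NumberField.discr K)) (ι : K →+* ℂ)
      (P : (W.baseChange K).toAffine.Point),
      ClassX11b W p → Surj W p → W.conductorNorm ℤ = N → IsImaginaryQuadratic K →
      Odd (NumberField.discr K) → ¬ (p : ℤ) ∣ NumberField.discr K → ¬ p ∣ Units.torsionOrder K →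
      SatisfiesHeegnerHypothesis N K →
      (W.quadraticTwist (NumberField.discr K : ℚ)).entireLFunction 1 ≠ 0 →
      WeierstrassCurve.Affine.Point.map ι.toRatAlgHom P = heegnerPointComplex Dt H →
      ¬ (p : ℤ) ∣ Dt.c → IndexLowerBoundAt W p K P)
    -- (T2) the Euler-system half where `p ∣ ∏ c_ℓ`
    (hU : ∀ (W : WeierstrassCurve ℚ) [W.IsElliptic] [W.IsGloballyMinimal] (p : ℕ) [Fact p.Prime],
      ClassX11b W p → 5 ≤ p → p ∣ W.tamagawaProduct → Typed.MissingUpperBoundAt W p)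
    -- (T3) the main-conjecture half on the rank-0 sister class X11a
    (hX11a : ∀ (Wd : WeierstrassCurve ℚ) [Wd.IsElliptic] [Wd.IsGloballyMinimal] (p : ℕ)
      [Fact p.Prime], ClassX11a Wd p → Typed.MissingLowerBoundAt Wd p) :
    ∀ (W : WeierstrassCurve ℚ) [W.IsElliptic] [W.IsGloballyMinimal] (p : ℕ) [Fact p.Prime],
      ClassX11b W p → 11 ≤ p → BSDp W p := by
  intro W _ _ p _ hX h11
  exact bsdp_of_classX11b_of_surj_of_typedInputs hGZ hKo hB hSk hWu hGZK hmod hnf hHL hFH hMaz hNS hL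
    hU hX11a W p hX (by omega) (ClassX11b.surj_of_eleven_le W p hBDMTV hX h11)

/-! ### `p ≥ 5`: the non-surjective corner LOCALISED at `p ∈ {5,7} ∧ p ∣ ord_p Δ_min ∧ ¬Ram` -/

/-- **X11b, whole class, `p ≥ 5`, with (T4) localised.** `BSD(E,p)` for EVERY pair `(E,p)` of
X11b with `p ≥ 5`, from the published facts (+ `hBDMTV`) and the typed inputs (T1) STEP L, (T2)
upper half where `p ∣ ∏c_ℓ`, (T3) X11a's lower half, and (T4′) `Typed.MissingPPartAt` on the
DECIDABLE sub-population `ClassX11b ∧ ¬Surj ∧ (p = 5 ∨ p = 7) ∧ p ∣ ord_p Δ_min(E) ∧ ¬Ram`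
(`ClassX11b.not_surj_shape`: Silverman *ATAEC* V.6.1 at `ℓ = p` + Serre Prop. 15 + BDMTV).
This refines (T4) of `bsdp_of_classX11b_five_of_typedInputs` (there: all of `ClassX11b ∧ ¬Surj`).
CONDITIONAL; nothing booked; X11b stays CONSTRUCTION-SHAPED.
[cite: SilvermanATAEC1994, V.6 Prop. 6.1 (p. 410)] [cite: SerreInventiones1972, §2.4 Prop. 15]
[cite: BalakrishnanEtAl2019, §1 Thm. 1.2 (arXiv:1711.05846 p. 2)]
[cite: JetchevSkinnerWan2017, §7.4.1–7.4.3 (pp. 30–31)] [cite: Miller2011LMS, Def. 1.1] -/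
theorem bsdp_of_classX11b_five_of_typedInputs_local
    -- published inputs (named facts of the tree)
    (hGZ : ∀ (N : ℕ) [NeZero N] (W : WeierstrassCurve ℚ) (K : Type) [Field K] [NumberField K],
      gross_zagier N W K)
    (hKo : ∀ (N : ℕ) [NeZero N] (W : WeierstrassCurve ℚ) (K : Type) [Field K] [NumberField K],
      kolyvagin N W K)
    (hB : ∀ (N : ℕ) [NeZero N] (W : WeierstrassCurve ℚ) (K : Type) [Field K] [NumberField K],
      Kolyvagin1990_padicValNat_card_sha_le N W K)
    (hSk : Skinner2016.thmC_padicValRat_bsd_rank_zero) (hWu : sha_dvd_analyticSha)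
    (hGZK : rank_eq_analyticRank_of_analyticRank_le_one) (hmod : hasEntireLFunction_rat)
    (hnf : exists_isNewformOf) (hHL : HoffsteinLuo1997_exists_twist_L_one_ne_zero)
    (hFH : friedbergHoffstein_exists_heegnerField_split_twist_ne_zero)
    (hMaz : mazur_not_dvd_maninConstant_of_odd) (hNS : integral_neronScaling_of_isGloballyMinimal)
    (hBDMTV : thm12_not_le_normalizer_splitCartan)
    -- (T1) the typed input of the route (STEP L), at the odd-`d_K` Heegner data of surjective X11b pairs
    (hL : ∀ (W : WeierstrassCurve ℚ) [W.IsElliptic] [W.IsGloballyMinimal] (p : ℕ) [Fact p.Prime]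
      (N : ℕ) [NeZero N] (K : Type) [Field K] [NumberField K]
      (Dt : ModularParametrizationData W N) (H : HeegnerDatum N (NumberField.discr K)) (ι : K →+* ℂ)
      (P : (W.baseChange K).toAffine.Point),
      ClassX11b W p → Surj W p → W.conductorNorm ℤ = N → IsImaginaryQuadratic K →
      Odd (NumberField.discr K) → ¬ (p : ℤ) ∣ NumberField.discr K → ¬ p ∣ Units.torsionOrder K →
      SatisfiesHeegnerHypothesis N K →
      (W.quadraticTwist (NumberField.discr K : ℚ)).entireLFunction 1 ≠ 0 →
      WeierstrassCurve.Affine.Point.map ι.toRatAlgHom P = heegnerPointComplex Dt H →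
      ¬ (p : ℤ) ∣ Dt.c → IndexLowerBoundAt W p K P)
    -- (T2) the Euler-system half where `p ∣ ∏ c_ℓ`
    (hU : ∀ (W : WeierstrassCurve ℚ) [W.IsElliptic] [W.IsGloballyMinimal] (p : ℕ) [Fact p.Prime],
      ClassX11b W p → 5 ≤ p → p ∣ W.tamagawaProduct → Typed.MissingUpperBoundAt W p)
    -- (T3) the main-conjecture half on the rank-0 sister class X11a
    (hX11a : ∀ (Wd : WeierstrassCurve ℚ) [Wd.IsElliptic] [Wd.IsGloballyMinimal] (p : ℕ)
      [Fact p.Prime], ClassX11a Wd p → Typed.MissingLowerBoundAt Wd p)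
    -- (T4′) the non-surjective corner, LOCALISED: `p ∈ {5,7}`, `p ∣ ord_p Δ_min`, no (ram) prime
    (hC : ∀ (W : WeierstrassCurve ℚ) [W.IsElliptic] [W.IsGloballyMinimal] (p : ℕ) [Fact p.Prime],
      ClassX11b W p → ¬ Surj W p → (p = 5 ∨ p = 7) →
        p ∣ padicValInt p W.minimalDiscriminantInt → ¬ Ram W p → Typed.MissingPPartAt W p) :
    ∀ (W : WeierstrassCurve ℚ) [W.IsElliptic] [W.IsGloballyMinimal] (p : ℕ) [Fact p.Prime],
      ClassX11b W p → 5 ≤ p → BSDp W p := by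
  intro W _ _ p _ hX hp5
  by_cases hs : Surj W p
  · exact bsdp_of_classX11b_of_surj_of_typedInputs hGZ hKo hB hSk hWu hGZK hmod hnf hHL hFH hMaz hNS
      hL hU hX11a W p hX hp5 hs
  · obtain ⟨h57, hdvd, hnr⟩ := ClassX11b.not_surj_shape W p hBDMTV hX hp5 hs
    exact Typed.bsdp_of_missingPPartAt W p hGZK (by rw [hX.1]) (hC W p hX hs h57 hdvd hnr)

/-- **The localised (T4′) implies gen 7's (T4) restricted to `p ≥ 5`** — i.e. the new class theorem
asks for NO MORE than the old one: any supplier of `Typed.MissingPPartAt` on `ClassX11b ∧ ¬Surj`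
supplies (T4′). (The converse direction is the content of `ClassX11b.not_surj_shape`.) [folklore] -/
theorem typedCornerLocal_of_typedCorner
    (hC : ∀ (W : WeierstrassCurve ℚ) [W.IsElliptic] [W.IsGloballyMinimal] (p : ℕ) [Fact p.Prime],
      ClassX11b W p → ¬ Surj W p → Typed.MissingPPartAt W p) :
    ∀ (W : WeierstrassCurve ℚ) [W.IsElliptic] [W.IsGloballyMinimal] (p : ℕ) [Fact p.Prime],
      ClassX11b W p → ¬ Surj W p → (p = 5 ∨ p = 7) →
        p ∣ padicValInt p W.minimalDiscriminantInt → ¬ Ram W p → Typed.MissingPPartAt W p :=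
  fun W _ _ p _ hX hs _ _ _ ↦ hC W p hX hs

end Summit.BirchSwinnertonDyer.Rank1Residual.X11b

end
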